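import Literature.NumberTheory.EllipticCurves.TateModuleTameDescentProofs
import Literature.NumberTheory.EllipticCurves.IsogenyQuadraticTwistProofs
import HarnessLib

/-!
# Quadratic twists and the inertia invariants of the Tate module: `Sw_𝔓(V_ℓ E) = 0` when a
# twist has a fixed line (Silverman *ATAEC* Thm. IV.10.2(b), case `v(j) < 0`, Galois half)

`Proofs` file (theorems only, no definitions, no named facts) in topic
`NumberTheory/EllipticCurves`, landed by the tenured seat of bsd.S15
(`Literature.NumberTheory.EllipticCurves.conductorNorm_eq_artinConductorNat`, `BSDConductor`) as
a bottom-up step below the named fact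
`WeierstrassCurve.swanConductorAt_rationalTate_eq_zero_of_ringChar_ne` of
`HasseWeilAbelianConductor` — Silverman, *Advanced Topics in the Arithmetic of Elliptic Curves*,
Thm. IV.10.2(b), clause `p ≥ 5` (*"… or if `p ≥ 5`, then `δ(E/K) = 0`"*, PDF p. 358 of the
held copy) — in its case `v(j) < 0` (potentially multiplicative reduction).  The printed proof
(PDF pp. 359–360) uses the Tate curve: over an extension `K'/K` of degree `≤ 2` the curve is
`E_q`, and `K'(E[ℓ])/K'` is at worst tamely ramified.  The tree replaces the Tate curve by the
**quadratic twist** `E^{(d)}` (`WeierstrassCurve.quadraticTwist`, `QuadraticTwist`), which over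
`K' = K(√d)` becomes isomorphic to `E` (`WeierstrassCurve.untwistEquiv`,
`IsogenyQuadraticTwistProofs`; Silverman *AEC* X.5 Cor. 5.4), and by Thm. IV.10.2(a) for
`E^{(d)}` at a place where it has multiplicative reduction (`codim (V_ℓ E^{(d)})^{I_𝔓} = 1`,
the named fact `codimFixed_inertia_rationalTate_eq_one_of_hasMultiplicativeReductionAt`); the
Galois half is then the tree's tame descent (`TateModuleTameDescentProofs`: a line of `V_ℓ E`
fixed by `I_𝔓 ∩ N` for an open normal `N ⊴ Γ_K` of index prime to `p` forces `Sw_𝔓 = 0`, by the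
unipotence of inertia and `det ρ_ℓ = χ_ℓ`).  This file supplies the transport:

* generic bookkeeping on Tate modules of fixed points:
  `Literature.NumberTheory.EllipticCurves.TateModule.finrank_eq_of_addEquiv`,
  `TateModule.finrank_le_of_injective`, `mem_fixedPoints_addSubgroup_iff`,
  `map_fixedPoints_addSubgroup_eq`, `nonempty_addEquiv_fixedPoints` (an `H`-equivariant
  additive isomorphism restricts to the `H`-fixed points), `fixedPoints_addSubgroup_antitone`,
  `TateModule.finrank_fixedPoints_eq_of_addEquiv`, `TateModule.finrank_fixedPoints_le_of_le`
  (`rank T_ℓ(A^H) ≤ rank T_ℓ(A^{H'})` for `H' ≤ H`, finite `ℓ`-torsion);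
* the subgroup `Γ_{K(√d)} = Stab_{Γ_K}(√d)` (`MulAction.stabilizer`, with the tree's
  `WeierstrassCurve.geomSqrt`): it is normal (`stabilizer_geomSqrt_normal`: `σ√d = ±√d`), open
  (`isOpen_stabilizer_geomSqrt`: it contains `Gal(K̄/K(√d))`, Krull), of index `1` or `2`
  (`index_stabilizer_geomSqrt`, the orbit of `√d` lies in `{√d, -√d}`), hence of index prime to
  every odd prime (`not_dvd_index_stabilizer_geomSqrt`);
* `WeierstrassCurve.exists_addEquiv_geomPoints_quadraticTwist` — **`E^{(d)}(K̄) ≃+ E(K̄)`,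
  `Γ_{K(√d)}`-equivariantly**: for any `W` over a field with `2 ≠ 0` and `d ≠ 0`, the composite
  of the transport `W^{(d)} = W₀^{(d)}` (`W₀ = W.toCharNeTwoNF • W`, `quadraticTwist_smul`), the
  untwisting isomorphism `W₀^{(d)}(K̄) ≃+ W₀(K̄)` (`untwistEquiv`, equivariant for the `σ` fixing
  `√d`, `untwistEquiv_smul_of_eq`) and the change of variables `W₀(K̄) ≃+ W(K̄)`
  (`VariableChange.pointEquivBaseChange`, `Γ_K`-equivariant);
* `WeierstrassCurve.finrank_tateModule_fixedPoints_quadraticTwist_eq` — hence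
  `rank T_ℓ(E^{(d)}(K̄)^H) = rank T_ℓ(E(K̄)^H)` for every `H ≤ Γ_{K(√d)}`;
* `WeierstrassCurve.codimFixed_inf_stabilizer_le_one_of_quadraticTwist` — **if
  `codim (V_ℓ E^{(d)})^{I} ≤ 1` then `codim (V_ℓ E)^{I ∩ Γ_{K(√d)}} ≤ 1`** (any `I ≤ Γ_K`; via the
  tree's `codim (V_ℓ E)^H = 2 - rank T_ℓ(E(K̄)^H)`, `TateModuleFixedPointsProofs`);
* `WeierstrassCurve.swanConductorAt_rationalTate_eq_zero_of_codimFixed_quadraticTwist_le_one` —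
  **for `K` a number field, `v ∤ 2ℓ`, `𝔓 ∣ v`: if some twist `E^{(d)}` has
  `codim (V_ℓ E^{(d)})^{I_𝔓} ≤ 1`, then `Sw_𝔓(V_ℓ E) = 0`**
  (`swanConductorAt_rationalTate_eq_zero_of_codimFixed_inf_inertia_le_one` with
  `N = Γ_{K(√d)}`, of index `≤ 2`, prime to the odd residue characteristic).

The geometric input — at a place `v ∤ 6` with `v(j) < 0` some twist `E^{(d)}` has multiplicative
reduction — is `QuadraticTwistMultiplicativeReductionProofs`; the assembly of Thm. IV.10.2(b)
from the two is `HasseWeilAbelianTameNegativeJProofs`.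

All axioms `propext`, `Classical.choice`, `Quot.sound`.

## References

* J. H. Silverman, *Advanced Topics in the Arithmetic of Elliptic Curves*, GTM 151 (1994), §IV.10,
  Thm. 10.2(b) and its proof (PDF pp. 358–362). [SilvermanATAEC1994]
* J. H. Silverman, *The Arithmetic of Elliptic Curves*, 2nd ed. (2009), X.2 Prop. 2.4, X.5
  Cor. 5.4 (twists), III.3.1(b) (changes of variables). [SilvermanAEC2009]
* J.-P. Serre, J. Tate, *Good reduction of abelian varieties*, Ann. of Math. 88 (1968), §1–§3.
  [SerreTate1968]

## Design

No definitions: the subgroup `Γ_{K(√d)}` is written `MulAction.stabilizer Γ_K (geomSqrt d)` and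
the equivariant isomorphism is produced existentially; `noncomputable section`,
`open scoped Classical`, one universe `u`; deliberate dot-notation extensions of Mathlib's
`WeierstrassCurve` namespace and of the tree's `Literature.NumberTheory.EllipticCurves.TateModule`,
as in the sibling files.
-/

noncomputable section

open scoped Classical AddSubgroup NumberField
open Field IsDedekindDomain

universe u

namespace Literature.NumberTheory.EllipticCurves

/-! ### Tate modules of isomorphic groups and of subgroups -/

namespace TateModule

variable {A : Type*} {B : Type*} [AddCommGroup A] [AddCommGroup B] (p : ℕ) [Fact p.Prime]

/-- **Functoriality of `T_p` on isomorphisms**: an additive isomorphism `A ≃+ B` induces a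
`ℤ_p`-linear isomorphism `T_p A ≃ T_p B` (`TateModule.map` of `e` and `e⁻¹`), so the ranks agree.
Silverman, *AEC*, III.§7 (`T_ℓ` is a functor). [folklore] -/
theorem finrank_eq_of_addEquiv (e : A ≃+ B) :
    Module.finrank ℤ_[p] (TateModule A p) = Module.finrank ℤ_[p] (TateModule B p) := by
  have h1 : (map p e.symm.toAddMonoidHom).comp (map p e.toAddMonoidHom) = LinearMap.id := by
    rw [← map_comp]
    have : e.symm.toAddMonoidHom.comp e.toAddMonoidHom = AddMonoidHom.id A := by
      ext a; simp
    rw [this, map_id]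
  have h2 : (map p e.toAddMonoidHom).comp (map p e.symm.toAddMonoidHom) = LinearMap.id := by
    rw [← map_comp]
    have : e.toAddMonoidHom.comp e.symm.toAddMonoidHom = AddMonoidHom.id B := by
      ext b; simp
    rw [this, map_id]
  exact (LinearEquiv.ofLinear (map p e.toAddMonoidHom) (map p e.symm.toAddMonoidHom) h2 h1).finrank_eq

/-- **Monotonicity of the rank of `T_p` along injections**: for an injective `f : A →+ B` with
`B[p]` finite (so that `T_p B` is a finitely generated `ℤ_p`-module,
`TateModule.finite_of_finite_torsionBy`), `rank T_p A ≤ rank T_p B` (`TateModule.map f` is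
injective, `map_injective_of_injective`). [folklore] -/
theorem finrank_le_of_injective (f : A →+ B) (hf : Function.Injective f)
    (hB : Finite (B[(p : ℕ)])) :
    Module.finrank ℤ_[p] (TateModule A p) ≤ Module.finrank ℤ_[p] (TateModule B p) := by
  haveI := finite_of_finite_torsionBy hB
  exact LinearMap.finrank_le_finrank_of_injective (map_injective_of_injective f hf)

end TateModule

/-! ### Fixed points under a subgroup: transport and monotonicity -/

section FixedPoints

variable {G : Type*} [Group G] {A : Type*} {B : Type*} [AddCommGroup A] [AddCommGroup B]
  [DistribMulAction G A] [DistribMulAction G B]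

/-- Membership in the fixed points `A^H` of a subgroup `H ≤ G` (Mathlib
`FixedPoints.addSubgroup` for the induced action of `↥H`). [folklore] -/
theorem mem_fixedPoints_addSubgroup_iff (H : Subgroup G) (a : A) :
    a ∈ FixedPoints.addSubgroup H A ↔ ∀ σ ∈ H, σ • a = a :=
  ⟨fun h σ hσ ↦ h ⟨σ, hσ⟩, fun h σ ↦ h σ σ.2⟩

/-- An `H`-equivariant additive isomorphism `e : A ≃+ B` maps `A^H` onto `B^H`. [folklore] -/
theorem map_fixedPoints_addSubgroup_eq (H : Subgroup G) (e : A ≃+ B)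
    (he : ∀ σ ∈ H, ∀ a : A, e (σ • a) = σ • e a) :
    (FixedPoints.addSubgroup H A).map (e : A →+ B) = FixedPoints.addSubgroup H B := by
  ext b
  simp only [AddSubgroup.mem_map, mem_fixedPoints_addSubgroup_iff, AddMonoidHom.coe_coe]
  constructor
  · rintro ⟨a, ha, rfl⟩ σ hσ
    rw [← he σ hσ, ha σ hσ]
  · intro hb
    refine ⟨e.symm b, fun σ hσ ↦ e.injective ?_, e.apply_symm_apply b⟩
    rw [he σ hσ, e.apply_symm_apply, hb σ hσ]

/-- **An `H`-equivariant additive isomorphism restricts to the fixed points**: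
`A^H ≃+ B^H`. [folklore] -/
theorem nonempty_addEquiv_fixedPoints (H : Subgroup G) (e : A ≃+ B)
    (he : ∀ σ ∈ H, ∀ a : A, e (σ • a) = σ • e a) :
    Nonempty (FixedPoints.addSubgroup H A ≃+ FixedPoints.addSubgroup H B) :=
  ⟨(e.addSubgroupMap (FixedPoints.addSubgroup H A)).trans
    (AddEquiv.addSubgroupCongr (map_fixedPoints_addSubgroup_eq H e he))⟩

/-- Fixed points grow as the subgroup shrinks: `H' ≤ H ⇒ A^H ≤ A^{H'}`. [folklore] -/
theorem fixedPoints_addSubgroup_antitone {H H' : Subgroup G} (h : H' ≤ H) :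
    FixedPoints.addSubgroup H A ≤ FixedPoints.addSubgroup H' A := by
  intro a ha
  rw [mem_fixedPoints_addSubgroup_iff] at ha ⊢
  exact fun σ hσ ↦ ha σ (h hσ)

/-- **Transport of `rank T_p(A^H)`** along an `H`-equivariant additive isomorphism `A ≃+ B`.
[folklore] -/
theorem TateModule.finrank_fixedPoints_eq_of_addEquiv (p : ℕ) [Fact p.Prime] (H : Subgroup G)
    (e : A ≃+ B) (he : ∀ σ ∈ H, ∀ a : A, e (σ • a) = σ • e a) :
    Module.finrank ℤ_[p] (TateModule (FixedPoints.addSubgroup H A) p) =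
      Module.finrank ℤ_[p] (TateModule (FixedPoints.addSubgroup H B) p) := by
  obtain ⟨e'⟩ := nonempty_addEquiv_fixedPoints H e he
  exact TateModule.finrank_eq_of_addEquiv p e'

/-- **`rank T_p(A^H) ≤ rank T_p(A^{H'})` for `H' ≤ H`** when `A[p]` is finite (the inclusion
`A^H ≤ A^{H'}` is injective and `(A^{H'})[p] ⊆ A[p]` is finite). [folklore] -/
theorem TateModule.finrank_fixedPoints_le_of_le (p : ℕ) [Fact p.Prime] {H H' : Subgroup G}
    (h : H' ≤ H) (hA : Finite (A[(p : ℕ)])) :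
    Module.finrank ℤ_[p] (TateModule (FixedPoints.addSubgroup H A) p) ≤
      Module.finrank ℤ_[p] (TateModule (FixedPoints.addSubgroup H' A) p) := by
  refine TateModule.finrank_le_of_injective p
    (AddSubgroup.inclusion (fixedPoints_addSubgroup_antitone (A := A) h))
    (AddSubgroup.inclusion_injective _) ?_
  exact finite_torsionBy_of_injective (FixedPoints.addSubgroup H' A).subtype
    (fun _ _ h ↦ Subtype.ext h) _ hA

end FixedPoints

end Literature.NumberTheory.EllipticCurves

namespace WeierstrassCurve

open Literature.NumberTheory.EllipticCurves Literature.NumberTheory.GaloisRepresentations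

variable {K : Type u} [Field K]

/-! ### The subgroup `Γ_{K(√d)} = Stab_{Γ_K}(√d)` -/

/-- **`Γ_{K(√d)}` is normal in `Γ_K`**: every `τ ∈ Γ_K` sends `√d` to `±√d` (`map_geomSqrt`),
so conjugation preserves the stabiliser of `√d` (it is the kernel of the quadratic character of
`K(√d)/K`). [folklore] -/
theorem stabilizer_geomSqrt_normal (d : K) :
    (MulAction.stabilizer (absoluteGaloisGroup K) (geomSqrt d)).Normal := by
  refine ⟨fun σ hσ τ ↦ ?_⟩
  rw [MulAction.mem_stabilizer_iff] at hσ ⊢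
  rw [mul_smul, mul_smul]
  have key : τ • (absoluteGaloisGroup.toAlgEquiv K τ⁻¹) (geomSqrt d) = geomSqrt d :=
    smul_inv_smul τ (geomSqrt d)
  rcases map_geomSqrt (absoluteGaloisGroup.toAlgEquiv K τ⁻¹) d with h | h
  · change τ • σ • (absoluteGaloisGroup.toAlgEquiv K τ⁻¹) (geomSqrt d) = geomSqrt d
    rw [h] at key ⊢
    rw [hσ]
    exact key
  · change τ • σ • (absoluteGaloisGroup.toAlgEquiv K τ⁻¹) (geomSqrt d) = geomSqrt d
    rw [h] at key ⊢
    rw [smul_neg, hσ]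
    exact key

/-- **`Γ_{K(√d)}` is open in `Γ_K`** (Krull topology): it contains the fixing subgroup
`Gal(K̄/K(√d))` of the finite extension `K(√d)` (Mathlib `IntermediateField.fixingSubgroup_isOpen`).
[folklore] -/
theorem isOpen_stabilizer_geomSqrt (d : K) :
    IsOpen (MulAction.stabilizer (absoluteGaloisGroup K) (geomSqrt d) :
      Set (absoluteGaloisGroup K)) := by
  let E : IntermediateField K (AlgebraicClosure K) := IntermediateField.adjoin K {geomSqrt d}
  haveI : FiniteDimensional K E :=
    IntermediateField.finiteDimensional_adjoin fun z _ ↦ Algebra.IsIntegral.isIntegral z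
  apply Subgroup.isOpen_mono (H₁ := E.fixingSubgroup) ?_ E.fixingSubgroup_isOpen
  intro σ hσ
  rw [IntermediateField.mem_fixingSubgroup_iff] at hσ
  exact hσ (geomSqrt d) (IntermediateField.subset_adjoin K _ (by simp))

/-- The `Γ_K`-orbit of `√d` lies in `{√d, -√d}`. [folklore] -/
theorem orbit_geomSqrt_subset (d : K) :
    MulAction.orbit (absoluteGaloisGroup K) (geomSqrt d) ⊆ {geomSqrt d, -geomSqrt d} := by
  rintro _ ⟨σ, rfl⟩
  rcases map_geomSqrt (absoluteGaloisGroup.toAlgEquiv K σ) d with h | h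
  · exact Or.inl h
  · exact Or.inr h

/-- **`[Γ_K : Γ_{K(√d)}] = 1` or `2`** (orbit–stabiliser, `MulAction.index_stabilizer`: the
index is the size of the orbit of `√d`, a non-empty subset of `{√d, -√d}`), i.e.
`[K(√d) : K] ≤ 2`. [folklore] -/
theorem index_stabilizer_geomSqrt (d : K) :
    (MulAction.stabilizer (absoluteGaloisGroup K) (geomSqrt d)).index = 1 ∨
      (MulAction.stabilizer (absoluteGaloisGroup K) (geomSqrt d)).index = 2 := by
  rw [MulAction.index_stabilizer]
  have hfin : (MulAction.orbit (absoluteGaloisGroup K) (geomSqrt d)).Finite :=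
    (Set.toFinite {geomSqrt d, -geomSqrt d}).subset (orbit_geomSqrt_subset d)
  have hle : (MulAction.orbit (absoluteGaloisGroup K) (geomSqrt d)).ncard ≤ 2 :=
    (Set.ncard_le_ncard (orbit_geomSqrt_subset d) (Set.toFinite _)).trans
      ((Set.ncard_insert_le _ _).trans (by rw [Set.ncard_singleton]))
  have hpos : 0 < (MulAction.orbit (absoluteGaloisGroup K) (geomSqrt d)).ncard :=
    (Set.ncard_pos hfin).mpr ⟨_, MulAction.mem_orbit_self _⟩
  omega

/-- `[Γ_K : Γ_{K(√d)}]` is prime to every odd prime `p` (it is `1` or `2`): the quadratic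
extension `K(√d)/K` has degree prime to `p` — the hypothesis of tame descent
(`absUpperRamificationSubgroup_le_of_not_dvd_index`, `TateModuleTameDescentProofs`). [folklore] -/
theorem not_dvd_index_stabilizer_geomSqrt (d : K) {p : ℕ} (hp : p.Prime) (hp2 : p ≠ 2) :
    ¬ p ∣ (MulAction.stabilizer (absoluteGaloisGroup K) (geomSqrt d)).index := by
  rcases index_stabilizer_geomSqrt d with h | h <;> rw [h]
  · exact hp.not_dvd_one
  · intro hdvd
    exact hp2 ((Nat.prime_dvd_prime_iff_eq hp Nat.prime_two).mp hdvd)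

/-! ### The `Γ_{K(√d)}`-equivariant isomorphism `E^{(d)}(K̄) ≃+ E(K̄)` -/

omit [Field K] in
/-- Transport of geometric points along an equality `X = Y` of Weierstrass equations over `K`
(`Affine.Point.congrEquiv` on the base changes to `K̄`, the identity on coordinates) commutes with
the coordinatewise action of `Aut_K(K̄)`. [folklore] -/
theorem congrEquiv_smul_of_eq [Field K] {X Y : WeierstrassCurve K} (h : X = Y)
    (σ : AlgebraicClosure K ≃ₐ[K] AlgebraicClosure K)
    (P : (X.baseChange (AlgebraicClosure K)).toAffine.Point) :
    Affine.Point.congrEquiv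
        (congrArg (fun Z : WeierstrassCurve K ↦ Z.baseChange (AlgebraicClosure K)) h) (σ • P) =
      σ • Affine.Point.congrEquiv
        (congrArg (fun Z : WeierstrassCurve K ↦ Z.baseChange (AlgebraicClosure K)) h) P := by
  subst h
  rfl

section Twist

variable [NeZero (2 : K)]

/-- **The twist is isomorphic to the curve over `K(√d)`, equivariantly** (Silverman, *AEC*, X.5
Cor. 5.4(iii): `E^{(d)} ≅ E` over `K(√d)`; X.2 Prop. 2.4).  For a Weierstrass equation `W`
over a field `K` with `2 ≠ 0` and `d ∈ K^*` there is an additive isomorphism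
`f : E^{(d)}(K̄) ≃+ E(K̄)` (`E^{(d)} = W.quadraticTwist d`) with `f(σP) = σ f(P)` for every
`σ ∈ Γ_K` fixing `√d`.  Construction: with `W₀ = W.toCharNeTwoNF • W` (a model with
`a₁ = a₃ = 0`) one has `W^{(d)} = W₀^{(d)}` (`quadraticTwist_smul`: the twist only sees
`b₂, b₄, b₆`, unchanged under `(1, 0, s, t)`); `f` is the identity transport
`W^{(d)}(K̄) = W₀^{(d)}(K̄)` followed by the untwisting isomorphism
`W₀^{(d)}(K̄) ≃+ W₀(K̄)`, `(x, y) ↦ (x/d, y/d√d)` (`untwistEquiv`, equivariant for `σ√d = √d`,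
`untwistEquiv_smul_of_eq`) and the inverse of the change of variables `W(K̄) ≃+ W₀(K̄)`
(`VariableChange.pointEquivBaseChange`, `Γ_K`-equivariant, `pointEquivBaseChange_map_algEquiv`).
[cite: SilvermanAEC2009, X.5 Cor. 5.4 and X.2 Prop. 2.4] -/
theorem exists_addEquiv_geomPoints_quadraticTwist (W : WeierstrassCurve K) {d : K} (hd : d ≠ 0) :
    ∃ f : (W.quadraticTwist d).geomPoints ≃+ W.geomPoints,
      ∀ σ : absoluteGaloisGroup K, σ • geomSqrt d = geomSqrt d →
        ∀ P, f (σ • P) = σ • f P := by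
  letI : Invertible (2 : K) := invertibleOfNonzero two_ne_zero
  set C : VariableChange K := W.toCharNeTwoNF with hC
  set V : WeierstrassCurve K := C • W with hV
  haveI : V.IsCharNeTwoNF := by rw [hV, hC]; infer_instance
  have hVW : W.quadraticTwist d = V.quadraticTwist d := by
    rw [hV, quadraticTwist_smul]
    have h1 : (⟨C.u, d * C.r, 0, 0⟩ : VariableChange K) = 1 := by
      simp only [hC, toCharNeTwoNF, mul_zero]
      rfl
    rw [h1, one_smul]
  let e₁ : (W.quadraticTwist d).geomPoints ≃+ (V.quadraticTwist d).geomPoints :=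
    Affine.Point.congrEquiv
      (congrArg (fun Z : WeierstrassCurve K ↦ Z.baseChange (AlgebraicClosure K)) hVW)
  let e₂ : (V.quadraticTwist d).geomPoints ≃+ V.geomPoints := untwistEquiv V hd
  let e₃ : V.geomPoints ≃+ W.geomPoints :=
    (VariableChange.pointEquivBaseChange W C (AlgebraicClosure K)).symm
  refine ⟨(e₁.trans e₂).trans e₃, fun σ hσ P ↦ ?_⟩
  simp only [AddEquiv.trans_apply]
  have h₁ : e₁ (σ • P) = σ • e₁ P :=
    congrEquiv_smul_of_eq hVW (absoluteGaloisGroup.toAlgEquiv K σ) P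
  have h₂ : e₂ (σ • e₁ P) = σ • e₂ (e₁ P) := untwistEquiv_smul_of_eq V hd σ hσ (e₁ P)
  have h₃ : ∀ Q : V.geomPoints, e₃ (σ • Q) = σ • e₃ Q := by
    intro Q
    apply (VariableChange.pointEquivBaseChange W C (AlgebraicClosure K)).injective
    change VariableChange.pointEquivBaseChange W C (AlgebraicClosure K)
        ((VariableChange.pointEquivBaseChange W C (AlgebraicClosure K)).symm
          (Affine.Point.map ((absoluteGaloisGroup.toAlgEquiv K σ : _) :
            AlgebraicClosure K →ₐ[K] AlgebraicClosure K) Q)) =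
      VariableChange.pointEquivBaseChange W C (AlgebraicClosure K)
        (Affine.Point.map ((absoluteGaloisGroup.toAlgEquiv K σ : _) :
            AlgebraicClosure K →ₐ[K] AlgebraicClosure K)
          ((VariableChange.pointEquivBaseChange W C (AlgebraicClosure K)).symm Q))
    rw [AddEquiv.apply_symm_apply, VariableChange.pointEquivBaseChange_map_algEquiv,
      AddEquiv.apply_symm_apply]
  rw [h₁, h₂, h₃]

/-- **`rank T_ℓ(E^{(d)}(K̄)^H) = rank T_ℓ(E(K̄)^H)` for `H ≤ Γ_{K(√d)}`**: the equivariant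
isomorphism of `exists_addEquiv_geomPoints_quadraticTwist` restricts to the `H`-fixed points
(`nonempty_addEquiv_fixedPoints`) and `T_ℓ` is a functor
(`TateModule.finrank_fixedPoints_eq_of_addEquiv`). [cite: SilvermanAEC2009, X.5 Cor. 5.4] -/
theorem finrank_tateModule_fixedPoints_quadraticTwist_eq (W : WeierstrassCurve K) {d : K}
    (hd : d ≠ 0) (ℓ : ℕ) [Fact ℓ.Prime] {H : Subgroup (absoluteGaloisGroup K)}
    (hH : H ≤ MulAction.stabilizer (absoluteGaloisGroup K) (geomSqrt d)) :
    Module.finrank ℤ_[ℓ] (TateModule (FixedPoints.addSubgroup H (W.quadraticTwist d).geomPoints) ℓ) =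
      Module.finrank ℤ_[ℓ] (TateModule (FixedPoints.addSubgroup H W.geomPoints) ℓ) := by
  obtain ⟨f, hf⟩ := W.exists_addEquiv_geomPoints_quadraticTwist hd
  exact TateModule.finrank_fixedPoints_eq_of_addEquiv ℓ H f fun σ hσ P ↦ hf σ (hH hσ) P

/-- **Inertia invariants of a twist with a fixed line.**  For an elliptic curve `E/K`
(`2 ≠ 0`, `ℓ ≠ char K`), `d ∈ K^*` and a subgroup `I ≤ Γ_K`: if `codim (V_ℓ E^{(d)})^{I} ≤ 1`
(e.g. `E^{(d)}` has good or multiplicative reduction at the place under the inertia group `I`,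
Silverman *ATAEC* Thm. IV.10.2(a)), then `codim (V_ℓ E)^{I ∩ Γ_{K(√d)}} ≤ 1`.  Indeed
`codim (V_ℓ E)^H = 2 - rank T_ℓ(E(K̄)^H)` (`codimFixed_rationalTate_eq_two_sub`,
`TateModuleFixedPointsProofs`), `rank T_ℓ(E^{(d)}(K̄)^{I}) ≤ rank T_ℓ(E^{(d)}(K̄)^{I ∩ Γ_{K(√d)}})`
(`TateModule.finrank_fixedPoints_le_of_le`) `= rank T_ℓ(E(K̄)^{I ∩ Γ_{K(√d)}})`
(`finrank_tateModule_fixedPoints_quadraticTwist_eq`).  This is the Galois shadow of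
"`E ≅ E^{(d)}` over `K(√d)`" used in the printed proof of Thm. IV.10.2(b) for `v(j) < 0` (PDF
pp. 359–360, with `E_q` in place of `E^{(d)}`).
[cite: SilvermanATAEC1994, proof of Thm. IV.10.2(b), case v(j) < 0 (PDF pp. 359–360)] -/
theorem codimFixed_inf_stabilizer_le_one_of_quadraticTwist (W : WeierstrassCurve K) [W.IsElliptic]
    (ℓ : ℕ) [Fact ℓ.Prime] (hℓ : (ℓ : K) ≠ 0)
    (h : Continuous fun x : absoluteGaloisGroup K × RationalTateModule (geomPoints W) ℓ ↦
      rationalTateRepresentation (absoluteGaloisGroup K) (geomPoints W) ℓ x.1 x.2)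
    {d : K} (hd : d ≠ 0)
    (h' : Continuous fun x : absoluteGaloisGroup K ×
        RationalTateModule (geomPoints (W.quadraticTwist d)) ℓ ↦
      rationalTateRepresentation (absoluteGaloisGroup K) (geomPoints (W.quadraticTwist d)) ℓ
        x.1 x.2)
    (I : Subgroup (absoluteGaloisGroup K))
    (hI : (rationalTateGaloisRepOf (geomPoints (W.quadraticTwist d)) ℓ h').codimFixed I ≤ 1) :
    (rationalTateGaloisRepOf (geomPoints W) ℓ h).codimFixed
        (I ⊓ MulAction.stabilizer (absoluteGaloisGroup K) (geomSqrt d)) ≤ 1 := by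
  haveI : (W.quadraticTwist d).IsElliptic := W.isElliptic_quadraticTwist hd
  set N := MulAction.stabilizer (absoluteGaloisGroup K) (geomSqrt d) with hN
  rw [(W.quadraticTwist d).codimFixed_rationalTate_eq_two_sub ℓ hℓ h' I] at hI
  rw [W.codimFixed_rationalTate_eq_two_sub ℓ hℓ h (I ⊓ N)]
  have h1 := TateModule.finrank_fixedPoints_le_of_le ℓ (A := (W.quadraticTwist d).geomPoints)
    (inf_le_left : I ⊓ N ≤ I) ((W.quadraticTwist d).finite_geomTorsion_prime ℓ)
  have h2 := W.finrank_tateModule_fixedPoints_quadraticTwist_eq hd ℓ (H := I ⊓ N) inf_le_right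
  omega

variable [NumberField K]

/-- **`Sw_𝔓(V_ℓ E) = 0` when a quadratic twist has a line fixed by inertia** (Silverman *ATAEC*
Thm. IV.10.2(b), case `v(j) < 0`, Galois half).  For an elliptic curve `E/K` over a number
field, a prime `ℓ`, a finite place `v ∤ ℓ` of **odd** residue characteristic `p`, a prime
`𝔓 ∣ v` of `\bar ℤ_K` and `d ∈ K^*`: if `codim (V_ℓ E^{(d)})^{I_𝔓} ≤ 1` (e.g. `E^{(d)}` has
multiplicative reduction at `v`, Thm. IV.10.2(a)), then the Swan conductor of `V_ℓ E` at `𝔓`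
vanishes.  Proof: `N = Γ_{K(√d)}` is open, normal, of index `1` or `2`, prime to `p`
(`isOpen_stabilizer_geomSqrt`, `stabilizer_geomSqrt_normal`, `not_dvd_index_stabilizer_geomSqrt`),
`codim (V_ℓ E)^{I_𝔓 ∩ N} ≤ 1` (`codimFixed_inf_stabilizer_le_one_of_quadraticTwist`), and tame
descent with the unipotence of inertia
(`swanConductorAt_rationalTate_eq_zero_of_codimFixed_inf_inertia_le_one`,
`TateModuleTameDescentProofs`: *"`[K':K]` is not divisible by `p` … so `L/K` is at worst tamely
ramified"*, PDF p. 362, here with `K' = K(√d)`, `[K':K] ≤ 2 < p`).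
[cite: SilvermanATAEC1994, Thm. IV.10.2(b) and its proof, case v(j) < 0 (PDF pp. 358–362)] -/
theorem swanConductorAt_rationalTate_eq_zero_of_codimFixed_quadraticTwist_le_one
    (W : WeierstrassCurve K) [W.IsElliptic] (ℓ : ℕ) [Fact ℓ.Prime]
    (h : Continuous fun x : absoluteGaloisGroup K × RationalTateModule (geomPoints W) ℓ ↦
      rationalTateRepresentation (absoluteGaloisGroup K) (geomPoints W) ℓ x.1 x.2)
    {v : HeightOneSpectrum (𝓞 K)} (hℓ : (ℓ : 𝓞 K) ∉ v.asIdeal)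
    (h2 : ringChar (𝓞 K ⧸ v.asIdeal) ≠ 2)
    {𝔓 : Ideal (absIntegers (𝓞 K) K)} (h𝔓 : 𝔓 ∈ v.primesAbove)
    {d : K} (hd : d ≠ 0)
    (h' : Continuous fun x : absoluteGaloisGroup K ×
        RationalTateModule (geomPoints (W.quadraticTwist d)) ℓ ↦
      rationalTateRepresentation (absoluteGaloisGroup K) (geomPoints (W.quadraticTwist d)) ℓ
        x.1 x.2)
    (hI : (rationalTateGaloisRepOf (geomPoints (W.quadraticTwist d)) ℓ h').codimFixed
      (𝔓.inertia (absoluteGaloisGroup K)) ≤ 1) :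
    (rationalTateGaloisRepOf (geomPoints W) ℓ h).swanConductorAt (𝓞 K) 𝔓 = 0 := by
  haveI := stabilizer_geomSqrt_normal d (K := K)
  have hℓK : (ℓ : K) ≠ 0 := by exact_mod_cast (Fact.out : ℓ.Prime).ne_zero
  have hp : (ringChar (𝓞 K ⧸ v.asIdeal)).Prime := by
    haveI : Finite (𝓞 K ⧸ v.asIdeal) := Ideal.finiteQuotientOfFreeOfNeBot v.asIdeal v.ne_bot
    exact CharP.char_is_prime (𝓞 K ⧸ v.asIdeal) _
  exact W.swanConductorAt_rationalTate_eq_zero_of_codimFixed_inf_inertia_le_one ℓ h hℓ h𝔓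
    (MulAction.stabilizer (absoluteGaloisGroup K) (geomSqrt d)) (isOpen_stabilizer_geomSqrt d)
    (not_dvd_index_stabilizer_geomSqrt d hp h2)
    (W.codimFixed_inf_stabilizer_le_one_of_quadraticTwist ℓ hℓK h hd h' _ hI)

end Twist

end WeierstrassCurve

end
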